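import Mathlib.Analysis.SpecialFunctions.Trigonometric.Bounds
import Mathlib.Algebra.Order.BigOperators.Group.Finset
import HarnessLib

/-!
# King 1986, §4: the `η = L^{-k} → 0` rate of the effective Laplacian of block averaging
# (Lemma 4.1, the composition law (4.12), Lemma 4.3 / Proposition 3.10 (3.91))

**Citation header (reproduction of PUBLISHED work; template file of the Bałaban lattice Yang–Mills
cell `pub-balaban`, TEMPLATE.md §18).**
C. King, *The U(1) Higgs model. I. The continuum limit*, Commun. Math. Phys. **102** (1986)
649–677 [King1986], §2.2 eq. (2.13) p. 653 (the constants `a_k`), §3.6 Proposition 3.10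
eq. (3.91) p. 669, and §4 "Technical Estimates" pp. 670–672: eqs. (4.4)–(4.8), Lemma 4.1 (4.9) with
its proof (4.10)–(4.11), the composition law (4.12), Lemma 4.2, Lemma 4.3 (4.18).  Page images of the
Euclid scan were read for every formula quoted below (cell folder
`b2b-balaban-template/king-renders/`).

**What King proves there (verbatim).**  For the unit-lattice effective Laplacian `Δ^{(k)}` obtained
from the operators of [Ba 4] = Bałaban, CMP **89** (1983) 571–597 after `k` block-averaging steps with
blocks of side `L` (relative fine lattice spacing `η = L^{-k}`, free boundary conditions, background
field `A = 0`), King gives the explicit Fourier representation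
"(4.4) `Δ^η(p) = 4η⁻² Σ_{μ=1}^d sin²(½ηp_μ) + m²(L^kε)²`,
 (4.5) `Δ^{(k)}(p′) = (a_k⁻¹ + Σ_l |u_k^η(p′+l)|² Δ^η(p′+l)⁻¹)⁻¹`"
and compares it with
"(4.6) `Δ̄^{(k)}(p′) = (a_k⁻¹ + Σ_l |u_k^η(p′+l)|² D⁻¹(p′+l))⁻¹`, where the operator `D` satisfies
 (i) `|D⁻¹(p) − (|p|² + m²(L^kε)²)⁻¹| ≤ CL^{−2k}` (4.7), (ii) `0 ≤ C|p|² ≤ D(p)` (4.8).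
 **Lemma 4.1.** `|Δ^{(k)}(p′) − Δ̄^{(k)}(p′)| ≤ CL^{−2k}Δ^{(k)}(p′)` (4.9).
 *Proof.* We first check that `Δ^η(p)` satisfies (4.7) and (4.8). By using `x² ≥ sin²x ≥ x² − x⁴/3`,
 we have `|Δ^η(p) − (|p|² + m²(L^kε)²)| ≤ Cη² Σ_μ |p_μ|⁴ ≤ CL^{−2k}|p|⁴` (4.10), from which (4.7)
 follows. The bound (4.8) is obvious. Since `Δ^η` and `D` are positive, we have `Δ^{(k)}(p′),
 Δ̄^{(k)}(p′) ≤ a_k`. Hence `|Δ^{(k)}(p′) − Δ̄^{(k)}(p′)| ≤ CΔ^{(k)}(p′)|Δ^{(k)}(p′)⁻¹ − Δ̄^{(k)}(p′)⁻¹|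
 ≤ CΔ^{(k)}(p′) Σ_l |u_k^η(p′+l)|² L^{−2k}` (4.11), where we used (4.7). Since `Σ_l |u_k^η(p′+l)|² = 1`,
 the bound (4.9) follows.
 To prove convergence of `Δ^{(k)}(p′)`, we notice that the composition law for renormalization
 transformations allows us to write `Δ^{(k+n)}(p′)` in the form (4.6), with
 `D⁻¹(p) = a_n⁻¹L^{−2k} + Σ_{l′} |u_n^{η′}(p+l′)|² Δ^{η′}(p+l′)⁻¹` (4.12) …
 **Lemma 4.2.** The operator (4.12) satisfies (4.7) and (4.8). …  Combining Lemmas 4.1 and 4.2 gives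
 **Lemma 4.3.** `|Δ^{(k)}(p′) − Δ^{(k+n)}(p′)| ≤ CL^{−2k}Δ^{(k)}(p′)` (4.18)."
This is Proposition 3.10 p. 669: "`|Δ^{(k)}(p)| ≤ C` uniformly in `k`,
`|Δ^{(k)}(p) − Δ^{(k+n)}(p)| ≤ CL^{−2k}|Δ^{(k)}(p)|` (3.91)", from which King gets (3.92)–(3.93), the
`L^{−2k}`-convergence of the quadratic form `⟨A_k, Δ^{(k)}A_k⟩` and of the Gaussian normalisations
`ln N_k` across lattice spacings `ε_K = L^{−K}` — an input of his Theorem 3.4 (convergence of the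
effective actions) and Theorem 2.1 (existence of the continuum limit `K → ∞` on a torus, `d = 2, 3`).

**What is reproduced here (everything PROVED; no named fact is introduced).**
* §1 `aK`: King's constants "`a_k = a(1 − L⁻²)(1 − L^{−2k})⁻¹` and `a` is `O(1)`" ((2.13) p. 653):
  positivity, the `k`-uniform two-sided bound `a(1 − L⁻²) ≤ a_k ≤ a`, and the algebraic
  COMPOSITION IDENTITY `a_{k+n}⁻¹ = a_k⁻¹ + L^{−2k} a_n⁻¹` behind the term `a_n⁻¹L^{−2k}` of (4.12).
* §2 the abstract form of (4.5)/(4.6): `effSymbol s a w A := (a⁻¹ + Σ_{i∈s} w_i (A_i)⁻¹)⁻¹` for a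
  finite alias set `s`, weights `w_i ≥ 0` (King: `w_l = |u_k^η(p′+l)|²`) and positive values `A_i`
  (King: `Δ^η(p′+l)`, resp. `D(p′+l)`): positivity and "`Δ^{(k)}, Δ̄^{(k)} ≤ a_k`".
* §3 LEMMA 4.1 in abstract form (`abs_effSymbol_sub_le`): if `Σ w_i ≤ 1` and
  `|(A_i)⁻¹ − (D_i)⁻¹| ≤ θ` for all `i ∈ s`, then `|Δ − Δ̄| ≤ a·θ·Δ` (and `≤ a·θ·Δ̄`) — exactly the
  chain (4.11); its "common reference" version (`abs_effSymbol_sub_le_of_ref`, hypotheses of the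
  printed shape (4.7) for BOTH `Δ^η` and `D` with the same reference `(|p|²+m²(L^kε)²)⁻¹` and
  constant `θ₀`, conclusion with `2θ₀`); the algebra of the composition law
  (`composed_denominator_eq`: with `Σ w = 1` the constant `a_n⁻¹L^{−2k}` distributes inside the alias
  sum, giving the form (4.6) with (4.12)); and LEMMA 4.3 / (3.91) as a theorem FROM the printed-shape
  hypothesis that each composed symbol has the form (4.6) with a `D` obeying (4.7) (= King's Lemma 4.2,
  whose trigonometric verification (4.14)–(4.17) is NOT reproduced) — `lemma43_of_composedForm`,
  `prop310_uniform_bound`.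
* §4 King's sentence "We first check that `Δ^η(p)` satisfies (4.7) and (4.8)" made fully explicit for
  the printed symbol (4.4): for `|ηp_μ| ≤ π` (the Brillouin zone of the `η`-lattice),
  `(4/π²)|p|² + M ≤ Δ^η(p) ≤ |p|² + M` and `|p|² + M − (η²/12)Σ_μ p_μ⁴ ≤ Δ^η(p)` ((4.10) with the
  constant `1/12`), hence `|Δ^η(p)⁻¹ − (|p|² + M)⁻¹| ≤ (π²/48)η²` ((4.7) with an explicit constant;
  `η² = L^{−2k}`), from Mathlib's `sin x ≤ x`, Jordan's inequality and `x − x³/6 ≤ sin x`.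

**NOT reproduced (enter §3 only as hypotheses, named as such).**  (a) The Parseval identity for block
averaging "`Σ_l |u_k^η(p′+l)|² = 1`" (used in §3 as the hypothesis `Σ w = 1`, resp. `≤ 1`);
(b) Lemma 4.2 = the bounds (4.14)–(4.17) showing that the composed `D` of (4.12) obeys (4.7)–(4.8);
(c) the multiple-reflection / [Ba 4] reduction of periodic and Neumann boundary conditions to free
ones (§4, first paragraph, p. 670); (d) everything downstream: Propositions 3.8–3.9 (the `L^{−γk}`
rate in position space for `a_kG_kQ_k^*` and the single-scale propagators `G_{(j)}`, pp. 664–665),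
Lemma 4.5 (4.38) (the rate `CL^{−k}e^{−δ₀|x−y|}` for the unit-lattice fluctuation covariance
`C^{(k)} = (Δ^{(k)} + aL⁻²Q^*Q)⁻¹` via the resolvent interpolation (4.32)/(4.39)–(4.41)).

**Why it is in the tree.**  King's §4 is the printed and proved `η → 0` CONVERGENCE-WITH-RATE statement
for the linear block-averaging objects of Bałaban's method in the scalar / abelian, zero-background
case — the layer that Bałaban's lattice Yang–Mills papers (CMP 89, 95, 96, 99) state only as bounds
UNIFORM in `η` (cell files t4/T4-DAG.md §6 NE2, BETA-SPEC (AF-0r), TEMPLATE.md §18).  SCOPE: King's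
model is the `U(1)` Higgs model in `d = 2, 3` with a non-compact (Gaussian) gauge field whose own
block-averaging operators are the scalar ones "(of course with `A = 0`)" (p. 656); nothing in this file
refers to or asserts anything about Bałaban's Yang–Mills papers, background-field dependent
propagators, covariant averages, or `d = 4`.
-/

noncomputable section

open Finset Real

namespace Literature.MathematicalPhysics.QuantumFieldTheory.King1986

/-! ## §1 The constants `a_k` of the `k`-fold block averaging ((2.13) p. 653) -/

/-- King's constants "`a_k = a(1 − L⁻²)(1 − L^{−2k})⁻¹` and `a` is `O(1)`", written with
`L^{−2} = (L²)⁻¹`, `L^{−2k} = (L^{2k})⁻¹`.  (For `k = 0` the printed formula is `0⁻¹`; Lean's `0⁻¹ = 0`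
gives `aK a L 0 = 0`, never used.) [cite: King1986, (2.13) p.653] -/
def aK (a L : ℝ) (k : ℕ) : ℝ := a * (1 - (L ^ 2)⁻¹) / (1 - (L ^ (2 * k))⁻¹)

/-- For `L > 1` and `k ≥ 1`: `0 < 1 − L^{−2k}`. [folklore] -/
theorem one_sub_inv_pow_pos {L : ℝ} (hL : 1 < L) {k : ℕ} (hk : 1 ≤ k) :
    0 < 1 - (L ^ (2 * k))⁻¹ := by
  have h1 : (1 : ℝ) < L ^ (2 * k) := one_lt_pow₀ hL (by omega)
  have h2 : (L ^ (2 * k))⁻¹ < 1 := inv_lt_one_of_one_lt₀ h1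
  linarith

/-- For `L > 1` and `k ≥ 1`: `1 − L⁻² ≤ 1 − L^{−2k}`. [folklore] -/
theorem one_sub_inv_sq_le {L : ℝ} (hL : 1 < L) {k : ℕ} (hk : 1 ≤ k) :
    1 - (L ^ 2)⁻¹ ≤ 1 - (L ^ (2 * k))⁻¹ := by
  have hL0 : 0 < L := by linarith
  have h1 : L ^ 2 ≤ L ^ (2 * k) := pow_le_pow_right₀ hL.le (by omega)
  have h2 : (L ^ (2 * k))⁻¹ ≤ (L ^ 2)⁻¹ := by
    apply inv_anti₀ (by positivity) h1
  linarith

/-- `a_k > 0` for `a > 0`, `L > 1`, `k ≥ 1`. [cite: King1986, (2.13) p.653] -/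
theorem aK_pos {a L : ℝ} (ha : 0 < a) (hL : 1 < L) {k : ℕ} (hk : 1 ≤ k) : 0 < aK a L k := by
  unfold aK
  have h1 : 0 < 1 - (L ^ 2)⁻¹ := by
    have := one_sub_inv_pow_pos hL (k := 1) le_rfl
    simpa using this
  exact div_pos (mul_pos ha h1) (one_sub_inv_pow_pos hL hk)

/-- The `k`-UNIFORM upper bound `a_k ≤ a` (`a_1 = a`, `a_k` decreasing): this is the content of
"`|Δ^{(k)}(p)| ≤ C` uniformly in `k`" of Proposition 3.10 once `Δ^{(k)} ≤ a_k` (§2).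
[cite: King1986, (2.13) p.653; Prop. 3.10 p.669] -/
theorem aK_le {a L : ℝ} (ha : 0 < a) (hL : 1 < L) {k : ℕ} (hk : 1 ≤ k) : aK a L k ≤ a := by
  unfold aK
  have hden : 0 < 1 - (L ^ (2 * k))⁻¹ := one_sub_inv_pow_pos hL hk
  rw [div_le_iff₀ hden]
  have := one_sub_inv_sq_le hL hk
  nlinarith

/-- The `k`-uniform lower bound `a(1 − L⁻²) ≤ a_k` (the `k → ∞` limit value).
[cite: King1986, (2.13) p.653] -/
theorem aK_ge {a L : ℝ} (ha : 0 < a) (hL : 1 < L) {k : ℕ} (hk : 1 ≤ k) :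
    a * (1 - (L ^ 2)⁻¹) ≤ aK a L k := by
  unfold aK
  have hden : 0 < 1 - (L ^ (2 * k))⁻¹ := one_sub_inv_pow_pos hL hk
  rw [le_div_iff₀ hden]
  have h1 : 0 < 1 - (L ^ 2)⁻¹ := by
    have := one_sub_inv_pow_pos hL (k := 1) le_rfl
    simpa using this
  have h3 : 1 - (L ^ (2 * k))⁻¹ ≤ 1 := by
    have : 0 ≤ (L ^ (2 * k))⁻¹ := by positivity
    linarith
  nlinarith [mul_pos ha h1]

/-- `a_1 = a`. [cite: King1986, (2.13) p.653] -/
theorem aK_one {a L : ℝ} (hL : 1 < L) : aK a L 1 = a := by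
  unfold aK
  have h1 : 0 < 1 - (L ^ 2)⁻¹ := by
    have := one_sub_inv_pow_pos hL (k := 1) le_rfl
    simpa using this
  simp only [mul_one]
  rw [mul_div_assoc, div_self h1.ne', mul_one]

/-- The inverse of `a_k` in closed form: `a_k⁻¹ = (1 − L^{−2k}) / (a(1 − L⁻²))`.
[cite: King1986, (2.13) p.653] -/
theorem inv_aK (a L : ℝ) (k : ℕ) :
    (aK a L k)⁻¹ = (1 - (L ^ (2 * k))⁻¹) / (a * (1 - (L ^ 2)⁻¹)) := by
  unfold aK
  rw [inv_div]

/-- THE COMPOSITION IDENTITY behind (4.12): `a_{k+n}⁻¹ = a_k⁻¹ + L^{−2k} a_n⁻¹` — `k + n` block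
averaging steps have the same Gaussian constant as `k` steps followed by `n` steps on the
`L^k`-coarser lattice, the latter seen through the rescaling factor `L^{−2k}`.
[cite: King1986, (2.13) p.653 with (4.12) p.671 ("D⁻¹(p) = a_n⁻¹L^{−2k} + …")] -/
theorem inv_aK_add {a L : ℝ} (ha : 0 < a) (hL : 1 < L) (k n : ℕ) :
    (aK a L (k + n))⁻¹ = (aK a L k)⁻¹ + (L ^ (2 * k))⁻¹ * (aK a L n)⁻¹ := by
  have hL0 : 0 < L := by linarith
  have h1 : 0 < 1 - (L ^ 2)⁻¹ := by
    have := one_sub_inv_pow_pos hL (k := 1) le_rfl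
    simpa using this
  have hc : a * (1 - (L ^ 2)⁻¹) ≠ 0 := (mul_pos ha h1).ne'
  rw [inv_aK a L, inv_aK a L, inv_aK a L]
  have hpow : (L ^ (2 * (k + n)))⁻¹ = (L ^ (2 * k))⁻¹ * (L ^ (2 * n))⁻¹ := by
    rw [← mul_inv, ← pow_add]; ring_nf
  rw [hpow]
  field_simp
  ring

/-! ## §2 The abstract form of (4.5)/(4.6): `Δ = (a⁻¹ + Σ_l w_l A_l⁻¹)⁻¹` -/

variable {ι : Type*}

/-- King's (4.5)/(4.6) as a function of the alias data: constant `a` (= `a_k`), weights `w_i`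
(= `|u_k^η(p′+l)|²`) and positive values `A_i` (= `Δ^η(p′+l)`, resp. `D(p′+l)`) over a finite set `s`
of aliases `l`: `(a⁻¹ + Σ_{i∈s} w_i A_i⁻¹)⁻¹`. [cite: King1986, (4.5)–(4.6) p.670] -/
def effSymbol (s : Finset ι) (a : ℝ) (w A : ι → ℝ) : ℝ := (a⁻¹ + ∑ i ∈ s, w i * (A i)⁻¹)⁻¹

/-- The denominator `a⁻¹ + Σ w_i A_i⁻¹` of (4.5). [cite: King1986, (4.5) p.670] -/
def effDenom (s : Finset ι) (a : ℝ) (w A : ι → ℝ) : ℝ := a⁻¹ + ∑ i ∈ s, w i * (A i)⁻¹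

/-- `Δ = (denominator)⁻¹` (definitional). [cite: King1986, (4.5) p.670] -/
theorem effSymbol_eq_inv_effDenom (s : Finset ι) (a : ℝ) (w A : ι → ℝ) :
    effSymbol s a w A = (effDenom s a w A)⁻¹ := rfl

/-- The alias sum `Σ w_i A_i⁻¹` is nonnegative for `w_i ≥ 0`, `A_i > 0`. [folklore] -/
theorem aliasSum_nonneg {s : Finset ι} {w A : ι → ℝ} (hw : ∀ i ∈ s, 0 ≤ w i)
    (hA : ∀ i ∈ s, 0 < A i) : 0 ≤ ∑ i ∈ s, w i * (A i)⁻¹ :=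
  Finset.sum_nonneg fun i hi => mul_nonneg (hw i hi) (inv_nonneg.mpr (hA i hi).le)

/-- "Since `Δ^η` and `D` are positive": the denominator is `≥ a⁻¹ > 0`.
[cite: King1986, proof of Lemma 4.1 p.671] -/
theorem inv_le_effDenom {s : Finset ι} {a : ℝ} {w A : ι → ℝ} (hw : ∀ i ∈ s, 0 ≤ w i)
    (hA : ∀ i ∈ s, 0 < A i) : a⁻¹ ≤ effDenom s a w A := by
  unfold effDenom
  have := aliasSum_nonneg hw hA
  linarith

/-- The denominator of (4.5) is positive. [cite: King1986, proof of Lemma 4.1 p.671] -/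
theorem effDenom_pos {s : Finset ι} {a : ℝ} (ha : 0 < a) {w A : ι → ℝ} (hw : ∀ i ∈ s, 0 ≤ w i)
    (hA : ∀ i ∈ s, 0 < A i) : 0 < effDenom s a w A :=
  lt_of_lt_of_le (inv_pos.mpr ha) (inv_le_effDenom hw hA)

/-- `Δ^{(k)}(p′) > 0`. [cite: King1986, proof of Lemma 4.1 p.671] -/
theorem effSymbol_pos {s : Finset ι} {a : ℝ} (ha : 0 < a) {w A : ι → ℝ} (hw : ∀ i ∈ s, 0 ≤ w i)
    (hA : ∀ i ∈ s, 0 < A i) : 0 < effSymbol s a w A := by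
  rw [effSymbol_eq_inv_effDenom]
  exact inv_pos.mpr (effDenom_pos ha hw hA)

/-- "Since `Δ^η` and `D` are positive, we have `Δ^{(k)}(p′), Δ̄^{(k)}(p′) ≤ a_k`."
[cite: King1986, proof of Lemma 4.1 p.671] -/
theorem effSymbol_le {s : Finset ι} {a : ℝ} (ha : 0 < a) {w A : ι → ℝ} (hw : ∀ i ∈ s, 0 ≤ w i)
    (hA : ∀ i ∈ s, 0 < A i) : effSymbol s a w A ≤ a := by
  rw [effSymbol_eq_inv_effDenom]
  have h := inv_le_effDenom (a := a) hw hA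
  calc (effDenom s a w A)⁻¹ ≤ (a⁻¹)⁻¹ := inv_anti₀ (inv_pos.mpr ha) h
    _ = a := inv_inv a

/-! ## §3 Lemma 4.1 (abstract form), the composition algebra of (4.12), Lemma 4.3 / (3.91) -/

/-- The difference of the two denominators is controlled by the alias-wise closeness of the inverse
values: `|(a⁻¹ + Σ w A⁻¹) − (a⁻¹ + Σ w D⁻¹)| ≤ θ Σ w ≤ θ` ("`≤ C Σ_l |u_k^η(p′+l)|² L^{−2k}` …
Since `Σ_l |u_k^η(p′+l)|² = 1`"). [cite: King1986, (4.11) p.671] -/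
theorem abs_effDenom_sub_le {s : Finset ι} {a θ : ℝ} {w A D : ι → ℝ} (hw : ∀ i ∈ s, 0 ≤ w i)
    (hw1 : ∑ i ∈ s, w i ≤ 1) (hθ : 0 ≤ θ) (hAD : ∀ i ∈ s, |(A i)⁻¹ - (D i)⁻¹| ≤ θ) :
    |effDenom s a w A - effDenom s a w D| ≤ θ := by
  unfold effDenom
  have hsub : a⁻¹ + ∑ i ∈ s, w i * (A i)⁻¹ - (a⁻¹ + ∑ i ∈ s, w i * (D i)⁻¹)
      = ∑ i ∈ s, w i * ((A i)⁻¹ - (D i)⁻¹) := by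
    rw [add_sub_add_left_eq_sub, ← Finset.sum_sub_distrib]
    refine Finset.sum_congr rfl fun i _ => by ring
  rw [hsub]
  calc |∑ i ∈ s, w i * ((A i)⁻¹ - (D i)⁻¹)|
      ≤ ∑ i ∈ s, |w i * ((A i)⁻¹ - (D i)⁻¹)| := Finset.abs_sum_le_sum_abs _ _
    _ = ∑ i ∈ s, w i * |(A i)⁻¹ - (D i)⁻¹| := by
        refine Finset.sum_congr rfl fun i hi => ?_
        rw [abs_mul, abs_of_nonneg (hw i hi)]
    _ ≤ ∑ i ∈ s, w i * θ :=
        Finset.sum_le_sum fun i hi => mul_le_mul_of_nonneg_left (hAD i hi) (hw i hi)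
    _ = (∑ i ∈ s, w i) * θ := by rw [Finset.sum_mul]
    _ ≤ 1 * θ := mul_le_mul_of_nonneg_right hw1 hθ
    _ = θ := one_mul θ

/-- **King's Lemma 4.1, abstract form.**  With weights `w_i ≥ 0`, `Σ w_i ≤ 1`, positive `A_i`, `D_i`
and `|(A_i)⁻¹ − (D_i)⁻¹| ≤ θ` for every alias `i`:
`|Δ − Δ̄| ≤ a·θ·Δ` where `Δ = (a⁻¹ + Σ w A⁻¹)⁻¹`, `Δ̄ = (a⁻¹ + Σ w D⁻¹)⁻¹` — the chain
"`|Δ − Δ̄| ≤ CΔ|Δ⁻¹ − Δ̄⁻¹|`" (using `Δ̄ ≤ a`) "`≤ CΔ Σ_l |u|² L^{−2k}`" of (4.11).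
[cite: King1986, Lemma 4.1 (4.9) p.671 with proof (4.11)] -/
theorem abs_effSymbol_sub_le {s : Finset ι} {a θ : ℝ} (ha : 0 < a) {w A D : ι → ℝ}
    (hw : ∀ i ∈ s, 0 ≤ w i) (hw1 : ∑ i ∈ s, w i ≤ 1) (hA : ∀ i ∈ s, 0 < A i)
    (hD : ∀ i ∈ s, 0 < D i) (hθ : 0 ≤ θ) (hAD : ∀ i ∈ s, |(A i)⁻¹ - (D i)⁻¹| ≤ θ) :
    |effSymbol s a w A - effSymbol s a w D| ≤ a * θ * effSymbol s a w A := by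
  have hX := effDenom_pos ha hw hA
  have hY := effDenom_pos ha hw hD
  rw [effSymbol_eq_inv_effDenom, effSymbol_eq_inv_effDenom]
  set X := effDenom s a w A with hXdef
  set Y := effDenom s a w D with hYdef
  -- `X⁻¹ − Y⁻¹ = (Y − X) X⁻¹ Y⁻¹`
  have hid : X⁻¹ - Y⁻¹ = (Y - X) * (X⁻¹ * Y⁻¹) := by
    field_simp
  rw [hid, abs_mul, abs_of_pos (mul_pos (inv_pos.mpr hX) (inv_pos.mpr hY))]
  have hdiff : |Y - X| ≤ θ := by
    rw [abs_sub_comm]; exact abs_effDenom_sub_le hw hw1 hθ hAD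
  -- `Y⁻¹ = Δ̄ ≤ a`
  have hYa : Y⁻¹ ≤ a := by
    have := effSymbol_le (s := s) ha hw hD
    rwa [effSymbol_eq_inv_effDenom] at this
  calc |Y - X| * (X⁻¹ * Y⁻¹) ≤ θ * (X⁻¹ * Y⁻¹) :=
        mul_le_mul_of_nonneg_right hdiff (mul_pos (inv_pos.mpr hX) (inv_pos.mpr hY)).le
    _ = θ * X⁻¹ * Y⁻¹ := by ring
    _ ≤ θ * X⁻¹ * a :=
        mul_le_mul_of_nonneg_left hYa (mul_nonneg hθ (inv_pos.mpr hX).le)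
    _ = a * θ * X⁻¹ := by ring

/-- The symmetric form: `|Δ − Δ̄| ≤ a·θ·Δ̄` as well. [cite: King1986, Lemma 4.1 p.671] -/
theorem abs_effSymbol_sub_le' {s : Finset ι} {a θ : ℝ} (ha : 0 < a) {w A D : ι → ℝ}
    (hw : ∀ i ∈ s, 0 ≤ w i) (hw1 : ∑ i ∈ s, w i ≤ 1) (hA : ∀ i ∈ s, 0 < A i)
    (hD : ∀ i ∈ s, 0 < D i) (hθ : 0 ≤ θ) (hAD : ∀ i ∈ s, |(A i)⁻¹ - (D i)⁻¹| ≤ θ) :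
    |effSymbol s a w A - effSymbol s a w D| ≤ a * θ * effSymbol s a w D := by
  have hDA : ∀ i ∈ s, |(D i)⁻¹ - (A i)⁻¹| ≤ θ := fun i hi => by
    rw [abs_sub_comm]; exact hAD i hi
  rw [abs_sub_comm]
  exact abs_effSymbol_sub_le ha hw hw1 hD hA hθ hDA

/-- King's hypothesis shape (4.7): BOTH `Δ^η` and `D` are `θ₀`-close, alias by alias, to the SAME
reference value `R_i = (|p′+l|² + m²(L^kε)²)⁻¹`; then `|(A_i)⁻¹ − (D_i)⁻¹| ≤ 2θ₀` ("where we used (4.7)"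
— for both operators). [cite: King1986, (4.7) p.671 and proof of Lemma 4.1] -/
theorem inv_sub_inv_le_of_ref {s : Finset ι} {θ₀ : ℝ} {A D R : ι → ℝ}
    (hAref : ∀ i ∈ s, |(A i)⁻¹ - R i| ≤ θ₀) (hDref : ∀ i ∈ s, |(D i)⁻¹ - R i| ≤ θ₀) :
    ∀ i ∈ s, |(A i)⁻¹ - (D i)⁻¹| ≤ 2 * θ₀ := by
  intro i hi
  have h1 := hAref i hi
  have h2 := hDref i hi
  calc |(A i)⁻¹ - (D i)⁻¹| = |((A i)⁻¹ - R i) - ((D i)⁻¹ - R i)| := by ring_nf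
    _ ≤ |(A i)⁻¹ - R i| + |(D i)⁻¹ - R i| := abs_sub _ _
    _ ≤ 2 * θ₀ := by linarith

/-- **Lemma 4.1 with the printed hypotheses (4.7) for `Δ^η` and for `D`**:
`|Δ^{(k)}(p′) − Δ̄^{(k)}(p′)| ≤ 2a_kθ₀ · Δ^{(k)}(p′)`, `θ₀ = CL^{−2k}`.
[cite: King1986, Lemma 4.1 (4.9) p.671] -/
theorem abs_effSymbol_sub_le_of_ref {s : Finset ι} {a θ₀ : ℝ} (ha : 0 < a) {w A D R : ι → ℝ}
    (hw : ∀ i ∈ s, 0 ≤ w i) (hw1 : ∑ i ∈ s, w i ≤ 1) (hA : ∀ i ∈ s, 0 < A i)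
    (hD : ∀ i ∈ s, 0 < D i) (hθ : 0 ≤ θ₀) (hAref : ∀ i ∈ s, |(A i)⁻¹ - R i| ≤ θ₀)
    (hDref : ∀ i ∈ s, |(D i)⁻¹ - R i| ≤ θ₀) :
    |effSymbol s a w A - effSymbol s a w D| ≤ a * (2 * θ₀) * effSymbol s a w A :=
  abs_effSymbol_sub_le ha hw hw1 hA hD (by linarith) (inv_sub_inv_le_of_ref hAref hDref)

/-- THE ALGEBRA OF THE COMPOSITION LAW (4.12).  After `k + n` steps the denominator of (4.5) reads
`a_{k+n}⁻¹ + Σ_{l,l′} |u_k^η(p′+l)|²|u_n^{η′}(p′+l+l′)|² Δ^{η′}(p′+l+l′)⁻¹` (multiplicativity of the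
averaging symbols, not reproduced); with `a_{k+n}⁻¹ = a_k⁻¹ + L^{−2k}a_n⁻¹` (`inv_aK_add`) and the
Parseval identity `Σ_l |u_k^η(p′+l)|² = 1` (hypothesis `hw1`) the constant `L^{−2k}a_n⁻¹` distributes
INSIDE the alias sum, which is exactly the form (4.6) with `D⁻¹(p′+l) = a_n⁻¹L^{−2k} + Σ_{l′} …` of
(4.12).  Here: outer weights `w` on `s` with `Σ w = 1`, arbitrary inner terms `inner i`
(= `Σ_{l′} |u_n^{η′}(p′+l+l′)|² Δ^{η′}(p′+l+l′)⁻¹`), constant `c` (= `L^{−2k}a_n⁻¹`).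
[cite: King1986, (4.12) p.671 ("the composition law for renormalization transformations allows us to write Δ^{(k+n)}(p′) in the form (4.6)")] -/
theorem composed_denominator_eq {s : Finset ι} {ainv c : ℝ} {w inner : ι → ℝ}
    (hw1 : ∑ i ∈ s, w i = 1) :
    ainv + c + ∑ i ∈ s, w i * inner i = ainv + ∑ i ∈ s, w i * (c + inner i) := by
  have : ∑ i ∈ s, w i * (c + inner i) = c * ∑ i ∈ s, w i + ∑ i ∈ s, w i * inner i := by
    rw [Finset.mul_sum, ← Finset.sum_add_distrib]
    refine Finset.sum_congr rfl fun i _ => by ring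
  rw [this, hw1, mul_one, add_assoc]

/-- The composed symbol IS an `effSymbol` with the same `a = a_k` and weights, and with
`D_i⁻¹ = c + inner_i` (4.12): if `Δ^{(k+n)}(p′) = (a_{k+n}⁻¹ + Σ_i w_i·inner_i)⁻¹`,
`a_{k+n}⁻¹ = a_k⁻¹ + c`, `Σ w = 1`, and `D_i := (c + inner_i)⁻¹`, then
`Δ^{(k+n)}(p′) = effSymbol s a_k w D`. [cite: King1986, (4.12) p.671] -/
theorem composed_eq_effSymbol {s : Finset ι} {a akn c : ℝ} {w inner : ι → ℝ}
    (hw1 : ∑ i ∈ s, w i = 1) (hakn : akn⁻¹ = a⁻¹ + c) :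
    (akn⁻¹ + ∑ i ∈ s, w i * inner i)⁻¹ = effSymbol s a w (fun i => (c + inner i)⁻¹) := by
  unfold effSymbol
  congr 1
  rw [hakn, composed_denominator_eq hw1]
  refine congrArg (a⁻¹ + ·) (Finset.sum_congr rfl fun i _ => ?_)
  rw [inv_inv]

/-- **King's Lemma 4.3 (4.18) / Proposition 3.10 (3.91), from the printed-shape hypotheses.**
Fix `k` (hence `a = a_k`, the alias set, the weights `w_l = |u_k^η(p′+l)|²` with `Σ w ≤ 1`, the
values `A_l = Δ^η(p′+l)` and the references `R_l`).  HYPOTHESES: (4.7) for `Δ^η` with constant `θ₀`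
(`hAref`; made explicit in §4 with `θ₀ = (π²/48)η²`), and — King's Lemma 4.2 with the composition law
(4.12), NOT reproduced — for every `n` the composed symbol `Δn n = Δ^{(k+n)}(p′)` has the form (4.6)
with a positive `D` obeying (4.7) with the same `θ₀` (`hform`).  CONCLUSION: for every `n`,
`|Δ^{(k)}(p′) − Δ^{(k+n)}(p′)| ≤ 2a_kθ₀ · Δ^{(k)}(p′)`, i.e. (4.18)/(3.91) with `CL^{−2k} = 2a_kθ₀`.
[cite: King1986, Lemma 4.3 (4.18) p.672; Prop. 3.10 (3.91) p.669] -/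
theorem lemma43_of_composedForm {s : Finset ι} {a θ₀ : ℝ} (ha : 0 < a) {w A R : ι → ℝ}
    (hw : ∀ i ∈ s, 0 ≤ w i) (hw1 : ∑ i ∈ s, w i ≤ 1) (hA : ∀ i ∈ s, 0 < A i) (hθ : 0 ≤ θ₀)
    (hAref : ∀ i ∈ s, |(A i)⁻¹ - R i| ≤ θ₀) (Δn : ℕ → ℝ)
    (hform : ∀ n, ∃ D : ι → ℝ, (∀ i ∈ s, 0 < D i) ∧ (∀ i ∈ s, |(D i)⁻¹ - R i| ≤ θ₀) ∧
      Δn n = effSymbol s a w D) :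
    ∀ n, |effSymbol s a w A - Δn n| ≤ 2 * a * θ₀ * effSymbol s a w A := by
  intro n
  obtain ⟨D, hD, hDref, hΔ⟩ := hform n
  rw [hΔ]
  have := abs_effSymbol_sub_le_of_ref ha hw hw1 hA hD hθ hAref hDref
  linarith

/-- The first clause of Proposition 3.10, "`|Δ^{(k)}(p)| ≤ C` uniformly in `k`": every symbol of the
form (4.5)/(4.6) with constant `a_k` is `≤ a_k ≤ a` (`aK_le`), `C = a`.
[cite: King1986, Prop. 3.10 p.669; (2.13) p.653] -/
theorem prop310_uniform_bound {s : Finset ι} {a L : ℝ} (ha : 0 < a) (hL : 1 < L) {k : ℕ}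
    (hk : 1 ≤ k) {w A : ι → ℝ} (hw : ∀ i ∈ s, 0 ≤ w i) (hA : ∀ i ∈ s, 0 < A i) :
    0 < effSymbol s (aK a L k) w A ∧ effSymbol s (aK a L k) w A ≤ a :=
  ⟨effSymbol_pos (aK_pos ha hL hk) hw hA,
    (effSymbol_le (aK_pos ha hL hk) hw hA).trans (aK_le ha hL hk)⟩

/-- The telescoped consequence used in (3.92)–(3.93): two composed symbols `Δ^{(k+n)}`, `Δ^{(k+n′)}`
differ by at most `4a_kθ₀Δ^{(k)}` — the family `n ↦ Δ^{(k+n)}(p′)` is Cauchy at rate `L^{−2k}`.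
[cite: King1986, Lemma 4.3 p.672 with (3.92)–(3.93) p.669] -/
theorem composed_cauchy {s : Finset ι} {a θ₀ : ℝ} (ha : 0 < a) {w A R : ι → ℝ}
    (hw : ∀ i ∈ s, 0 ≤ w i) (hw1 : ∑ i ∈ s, w i ≤ 1) (hA : ∀ i ∈ s, 0 < A i) (hθ : 0 ≤ θ₀)
    (hAref : ∀ i ∈ s, |(A i)⁻¹ - R i| ≤ θ₀) (Δn : ℕ → ℝ)
    (hform : ∀ n, ∃ D : ι → ℝ, (∀ i ∈ s, 0 < D i) ∧ (∀ i ∈ s, |(D i)⁻¹ - R i| ≤ θ₀) ∧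
      Δn n = effSymbol s a w D) (n n' : ℕ) :
    |Δn n - Δn n'| ≤ 4 * a * θ₀ * effSymbol s a w A := by
  have h1 := lemma43_of_composedForm ha hw hw1 hA hθ hAref Δn hform n
  have h2 := lemma43_of_composedForm ha hw hw1 hA hθ hAref Δn hform n'
  calc |Δn n - Δn n'| = |(effSymbol s a w A - Δn n') - (effSymbol s a w A - Δn n)| := by ring_nf
    _ ≤ |effSymbol s a w A - Δn n'| + |effSymbol s a w A - Δn n| := abs_sub _ _
    _ ≤ 4 * a * θ₀ * effSymbol s a w A := by linarith

/-! ## §4 "(4.7) and (4.8) for `Δ^η`": the printed symbol (4.4), with explicit constants -/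

/-- The one-dimensional finite-difference symbol `4η⁻² sin²(½ηx)` of (4.4).
[cite: King1986, (4.4) p.670] -/
def fdSymbol (η x : ℝ) : ℝ := 4 / η ^ 2 * Real.sin (η * x / 2) ^ 2

/-- `4η⁻² sin²(½ηx) ≤ x²` ("`x² ≥ sin²x`"). [cite: King1986, proof of Lemma 4.1 p.671] -/
theorem fdSymbol_le_sq {η : ℝ} (hη : η ≠ 0) (x : ℝ) : fdSymbol η x ≤ x ^ 2 := by
  unfold fdSymbol
  have h := Real.sin_sq_le_sq (x := η * x / 2)
  have hη2 : 0 < η ^ 2 := by positivity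
  calc 4 / η ^ 2 * Real.sin (η * x / 2) ^ 2 ≤ 4 / η ^ 2 * (η * x / 2) ^ 2 :=
        mul_le_mul_of_nonneg_left h (by positivity)
    _ = x ^ 2 := by field_simp; ring

/-- `fdSymbol η x ≥ 0`. [folklore] -/
theorem fdSymbol_nonneg (η x : ℝ) : 0 ≤ fdSymbol η x := by
  unfold fdSymbol; positivity

/-- Jordan's inequality on the Brillouin zone `|ηx| ≤ π`: `4η⁻² sin²(½ηx) ≥ (4/π²)x²` — the
concrete content of "(4.8) `0 ≤ C|p|² ≤ D(p)` … is obvious" for `D = Δ^η`.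
[cite: King1986, (4.8) p.671] -/
theorem fdSymbol_ge_jordan {η : ℝ} (hη : η ≠ 0) {x : ℝ} (hx : |η * x| ≤ π) :
    4 / π ^ 2 * x ^ 2 ≤ fdSymbol η x := by
  unfold fdSymbol
  have hz : |η * x / 2| ≤ π / 2 := by
    rw [abs_div, abs_two]; linarith
  have hj := Real.mul_abs_le_abs_sin hz
  -- square Jordan: (2/π |ηx/2|)² ≤ sin² (ηx/2)
  have hj2 : (2 / π * |η * x / 2|) ^ 2 ≤ Real.sin (η * x / 2) ^ 2 := by
    have h0 : 0 ≤ 2 / π * |η * x / 2| := by positivity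
    calc (2 / π * |η * x / 2|) ^ 2 ≤ |Real.sin (η * x / 2)| ^ 2 :=
          pow_le_pow_left₀ h0 hj 2
      _ = Real.sin (η * x / 2) ^ 2 := sq_abs _
  have hη2 : 0 < η ^ 2 := by positivity
  have hπ : 0 < π := Real.pi_pos
  calc 4 / π ^ 2 * x ^ 2 = 4 / η ^ 2 * (2 / π * |η * x / 2|) ^ 2 := by
        rw [mul_pow, sq_abs]
        field_simp
    _ ≤ 4 / η ^ 2 * Real.sin (η * x / 2) ^ 2 := mul_le_mul_of_nonneg_left hj2 (by positivity)

/-- The quartic lower bound "`sin²x ≥ x² − x⁴/3`" in the form needed for (4.10): for `|ηx| ≤ π`,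
`4η⁻² sin²(½ηx) ≥ x² − (η²/12)x⁴` (from `y − y³/6 ≤ sin y` for `0 ≤ y = |ηx|/2 ≤ π/2 ≤ √6`).
[cite: King1986, (4.10) p.671] -/
theorem fdSymbol_ge_quartic {η : ℝ} (hη : η ≠ 0) {x : ℝ} (hx : |η * x| ≤ π) :
    x ^ 2 - η ^ 2 / 12 * x ^ 4 ≤ fdSymbol η x := by
  unfold fdSymbol
  set y := |η * x / 2| with hy
  have hy0 : 0 ≤ y := abs_nonneg _
  have hyπ : y ≤ π / 2 := by rw [hy, abs_div, abs_two]; linarith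
  have hy2 : y ≤ 2 := by linarith [Real.pi_le_four]
  -- sin² is even: sin(ηx/2)² = sin(y)²
  have hsq : Real.sin (η * x / 2) ^ 2 = Real.sin y ^ 2 := by
    rcases abs_choice (η * x / 2) with h | h
    · rw [hy, h]
    · rw [hy, h, Real.sin_neg, neg_sq]
  rw [hsq]
  have hcube := Real.sin_ge_sub_cube hy0
  -- `y − y³/6 ≥ 0` since `y² ≤ 4 ≤ 6`
  have hy2sq : y ^ 2 ≤ 4 := by nlinarith
  have hnn : 0 ≤ y - y ^ 3 / 6 := by
    have h3 : y * y ^ 2 ≤ y * 4 := mul_le_mul_of_nonneg_left hy2sq hy0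
    have h4 : y ^ 3 ≤ 4 * y := by
      calc y ^ 3 = y * y ^ 2 := by ring
        _ ≤ y * 4 := h3
        _ = 4 * y := by ring
    linarith
  have hsin2 : (y - y ^ 3 / 6) ^ 2 ≤ Real.sin y ^ 2 := pow_le_pow_left₀ hnn hcube 2
  have hexp : y ^ 2 - y ^ 4 / 3 ≤ (y - y ^ 3 / 6) ^ 2 := by nlinarith [sq_nonneg (y ^ 3)]
  have hy2eq : y ^ 2 = η ^ 2 * x ^ 2 / 4 := by
    rw [hy, sq_abs]; ring
  have hy4eq : y ^ 4 = η ^ 4 * x ^ 4 / 16 := by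
    have : y ^ 4 = (y ^ 2) ^ 2 := by ring
    rw [this, hy2eq]; ring
  have hη2 : 0 < η ^ 2 := by positivity
  calc x ^ 2 - η ^ 2 / 12 * x ^ 4 = 4 / η ^ 2 * (y ^ 2 - y ^ 4 / 3) := by
        rw [hy2eq, hy4eq]; field_simp; ring
    _ ≤ 4 / η ^ 2 * (y - y ^ 3 / 6) ^ 2 := mul_le_mul_of_nonneg_left hexp (by positivity)
    _ ≤ 4 / η ^ 2 * Real.sin y ^ 2 := mul_le_mul_of_nonneg_left hsin2 (by positivity)

variable {d : Type*} [Fintype d]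

/-- King's symbol (4.4) on the `η`-lattice: `Δ^η(p) = 4η⁻² Σ_μ sin²(½ηp_μ) + M` with the mass term
`M = m²(L^kε)² ≥ 0`. [cite: King1986, (4.4) p.670] -/
def latticeSymbol (η M : ℝ) (p : d → ℝ) : ℝ := (∑ μ, fdSymbol η (p μ)) + M

/-- `|p|² = Σ_μ p_μ²`. [cite: King1986, (4.7) p.671] -/
def momSq (p : d → ℝ) : ℝ := ∑ μ, p μ ^ 2

/-- `|p|² ≥ 0`. [folklore] -/
theorem momSq_nonneg (p : d → ℝ) : 0 ≤ momSq p := Finset.sum_nonneg fun _ _ => sq_nonneg _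

/-- The upper half of (4.10): `Δ^η(p) ≤ |p|² + M`. [cite: King1986, (4.10) p.671] -/
theorem latticeSymbol_le {η : ℝ} (hη : η ≠ 0) (M : ℝ) (p : d → ℝ) :
    latticeSymbol η M p ≤ momSq p + M := by
  unfold latticeSymbol momSq
  have := Finset.sum_le_sum (s := Finset.univ) fun μ _ => fdSymbol_le_sq hη (p μ)
  linarith

/-- (4.8) for `Δ^η`: `(4/π²)|p|² + M ≤ Δ^η(p)` on the Brillouin zone `|ηp_μ| ≤ π`.
[cite: King1986, (4.8) p.671] -/
theorem latticeSymbol_ge_jordan {η : ℝ} (hη : η ≠ 0) (M : ℝ) {p : d → ℝ}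
    (hp : ∀ μ, |η * p μ| ≤ π) : 4 / π ^ 2 * momSq p + M ≤ latticeSymbol η M p := by
  unfold latticeSymbol momSq
  rw [Finset.mul_sum]
  have := Finset.sum_le_sum (s := Finset.univ) fun μ _ => fdSymbol_ge_jordan hη (hp μ)
  linarith

/-- The lower half of (4.10) with the constant made explicit:
`|p|² + M − (η²/12) Σ_μ p_μ⁴ ≤ Δ^η(p)` on `|ηp_μ| ≤ π`. [cite: King1986, (4.10) p.671] -/
theorem latticeSymbol_ge_quartic {η : ℝ} (hη : η ≠ 0) (M : ℝ) {p : d → ℝ}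
    (hp : ∀ μ, |η * p μ| ≤ π) :
    momSq p + M - η ^ 2 / 12 * ∑ μ, p μ ^ 4 ≤ latticeSymbol η M p := by
  unfold latticeSymbol momSq
  have := Finset.sum_le_sum (s := Finset.univ) fun μ _ => fdSymbol_ge_quartic hη (hp μ)
  rw [Finset.sum_sub_distrib] at this
  rw [Finset.mul_sum]
  have h2 : ∑ μ, η ^ 2 / 12 * p μ ^ 4 = ∑ μ, (η ^ 2 / 12 * p μ ^ 4) := rfl
  linarith

/-- "`Σ_μ |p_μ|⁴ ≤ |p|⁴`" (sum of squares of nonnegative reals `≤` square of the sum).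
[cite: King1986, (4.10) p.671] -/
theorem sum_pow_four_le_momSq_sq (p : d → ℝ) : ∑ μ, p μ ^ 4 ≤ momSq p ^ 2 := by
  unfold momSq
  have hle : ∀ μ ∈ (Finset.univ : Finset d), p μ ^ 2 ≤ ∑ ν, p ν ^ 2 := fun μ _ =>
    Finset.single_le_sum (fun ν _ => sq_nonneg (p ν)) (Finset.mem_univ μ)
  calc ∑ μ, p μ ^ 4 = ∑ μ, p μ ^ 2 * p μ ^ 2 := Finset.sum_congr rfl fun μ _ => by ring
    _ ≤ ∑ μ, p μ ^ 2 * ∑ ν, p ν ^ 2 :=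
        Finset.sum_le_sum fun μ hμ => mul_le_mul_of_nonneg_left (hle μ hμ) (sq_nonneg _)
    _ = (∑ μ, p μ ^ 2) ^ 2 := by rw [← Finset.sum_mul]; ring

/-- **(4.7) for `Δ^η`, explicit constant**: on the Brillouin zone and for `|p| ≠ 0`, `M ≥ 0`,
`|Δ^η(p)⁻¹ − (|p|² + M)⁻¹| ≤ (π²/48) η²` (King: "`≤ CL^{−2k}`", `η = L^{−k}`).  Proof as printed:
`|Δ^η − (|p|²+M)| ≤ (η²/12)|p|⁴` ((4.10)) divided by `Δ^η(|p|²+M) ≥ (4/π²)|p|²·|p|²` ((4.8)).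
[cite: King1986, (4.7) and (4.10) p.671] -/
theorem latticeSymbol_inv_sub_ref_le {η : ℝ} (hη : η ≠ 0) {M : ℝ} (hM : 0 ≤ M) {p : d → ℝ}
    (hp : ∀ μ, |η * p μ| ≤ π) (hp0 : 0 < momSq p) :
    |(latticeSymbol η M p)⁻¹ - (momSq p + M)⁻¹| ≤ π ^ 2 / 48 * η ^ 2 := by
  set Δ := latticeSymbol η M p with hΔ
  set P := momSq p with hP
  have hπ : 0 < π := Real.pi_pos
  have hlow : 4 / π ^ 2 * P + M ≤ Δ := latticeSymbol_ge_jordan hη M hp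
  have hΔpos : 0 < Δ := by
    have : 0 < 4 / π ^ 2 * P := by positivity
    linarith
  have hR : 0 < P + M := by linarith
  have hup : Δ ≤ P + M := latticeSymbol_le hη M p
  have hq : P + M - η ^ 2 / 12 * ∑ μ, p μ ^ 4 ≤ Δ := latticeSymbol_ge_quartic hη M hp
  have h4 : ∑ μ, p μ ^ 4 ≤ P ^ 2 := sum_pow_four_le_momSq_sq p
  -- the difference of inverses is nonnegative and equals (P+M−Δ)/(Δ(P+M))
  have hid : Δ⁻¹ - (P + M)⁻¹ = (P + M - Δ) / (Δ * (P + M)) := by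
    field_simp
  rw [hid, abs_of_nonneg (div_nonneg (by linarith) (mul_pos hΔpos hR).le)]
  rw [div_le_iff₀ (mul_pos hΔpos hR)]
  -- numerator ≤ (η²/12) P², denominator ≥ (4/π²) P · P
  have hnum : P + M - Δ ≤ η ^ 2 / 12 * P ^ 2 := by
    have : η ^ 2 / 12 * ∑ μ, p μ ^ 4 ≤ η ^ 2 / 12 * P ^ 2 :=
      mul_le_mul_of_nonneg_left h4 (by positivity)
    linarith
  have hden : 4 / π ^ 2 * P * P ≤ Δ * (P + M) := by
    have h1 : 4 / π ^ 2 * P ≤ Δ := by linarith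
    have h2 : P ≤ P + M := by linarith
    exact mul_le_mul h1 h2 hp0.le hΔpos.le
  calc P + M - Δ ≤ η ^ 2 / 12 * P ^ 2 := hnum
    _ = π ^ 2 / 48 * η ^ 2 * (4 / π ^ 2 * P * P) := by field_simp; ring
    _ ≤ π ^ 2 / 48 * η ^ 2 * (Δ * (P + M)) :=
        mul_le_mul_of_nonneg_left hden (by positivity)

end Literature.MathematicalPhysics.QuantumFieldTheory.King1986

end
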